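import Summits.CriticalPhenomena.Ising3DConformalLimit.Theses.BallSpecification
import Literature.Probability.LatticeModels.MoebiusWeightedAction
import Summits.CriticalPhenomena.Ising3DConformalLimit.Theorems.PrecisionLaplacianMoebiusLimitOfTwoPointLawSphereInversionCoV
import HarnessLib

/-!
# Stub `stub_momentTransfer` of line `birth` (skeleton r2) for crux `BallSpecifiedInversionUpgrade` (stmt-CriticalPhenomena-11248)

Route `route-CriticalPhenomena-BallSpecification`, sub-problem `Ising3DConformalLimit`.  Target tree file:
`Summits/CriticalPhenomena/Ising3DConformalLimit/Theorems/BallSpecificationBallSpecifiedInversionUpgradeMomentTransfer.lean`,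
landed with `--supports stmt-CriticalPhenomena-11248` (the theorem name and statement below are the REGISTERED stub; do not change them).

## Content (model-free real analysis)

If every `S n` is continuous on the non-coincident configurations, `S` vanishes off them, `S` is the
moment density of a law `μ` on field configurations over `ℝ³`, and the moments of `μ` are invariant under
the weight-`Δ` pull-back `ι^*_Δ = moebiusWeightedAction unitInversion Δ` on families of test functions
compactly supported in the annuli `R_s = {s < ‖x‖ < s⁻¹}` (`0 < s < 1`), then `S` is inversion covariant
with weight `Δ` pointwise (`IsInversionCovariant Δ S`).

Proof: for a family of bumps `φᵢ` centred at an off-origin non-coincident configuration `y`, the moment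
identity, `HasMomentDensity` and the change of variables `integral_sphereInversion_transfer` (`λ = 1`) give
`∫ S(x) ∏ φᵢ(xᵢ) dx = ∫ G(x) ∏ φᵢ(xᵢ) dx` with `G x = S(ι x) ∏ (1/‖xᵢ‖²)^Δ`; both `S` and `G` are
continuous near `y`, so letting the bumps shrink forces `S y = G y`, which is the covariance identity after
`rpow` algebra. Coincident configurations are handled by the normalisation `S = 0` off `NonCoincident`.
-/

namespace Summit.CriticalPhenomena.Ising3DConformalLimit.BallSpecificationBallSpecifiedInversionUpgrade

open MeasureTheory
open scoped SchwartzMap Topology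
open Metric Set Filter EuclideanGeometry
open Literature.Probability.LatticeModels Literature.MathematicalPhysics.QuantumLattice
open Summit.CriticalPhenomena.Ising3DConformalLimit.PrecisionLaplacianMoebiusLimitOfTwoPointLaw
  (integral_sphereInversion_transfer isOpen_forall_ne_zero)
open Summit.CriticalPhenomena.Ising3DConformalLimit.Theorems.MoebiusLimitOfTwoPointLaw.Negative
  (sphereInversion_eq_smul_inversion)

local notation "E3" => EuclideanSpace ℝ (Fin 3)

/-! ## Elementary helpers -/

/-- A finite family of positive reals has a common strict lower bound in `(0, 1)`. -/
private theorem mt_exists_small {ι : Type*} [Finite ι] (a : ι → ℝ) (ha : ∀ i, 0 < a i) :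
    ∃ s : ℝ, 0 < s ∧ s < 1 ∧ ∀ i, s < a i := by
  have hev : ∀ᶠ s in 𝓝 (0 : ℝ), s < 1 ∧ ∀ i, s < a i :=
    (eventually_lt_nhds one_pos).and (eventually_all.2 fun i => eventually_lt_nhds (ha i))
  obtain ⟨ε, hε, h⟩ := Metric.eventually_nhds_iff.1 hev
  have hd : dist (ε / 2) 0 < ε := by
    rw [Real.dist_eq, sub_zero, abs_of_pos (by positivity)]
    linarith
  exact ⟨ε / 2, by positivity, (h hd).1, (h hd).2⟩

/-! ## Products of bump functions on configuration space -/

section Bumps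

variable {n : ℕ} {z : Fin n → E3}

/-- The product `x ↦ ∏ᵢ φᵢ(xᵢ)` of bumps is continuous. -/
private theorem mt_prod_bump_continuous (φ : ∀ i, ContDiffBump (z i)) :
    Continuous fun x : Fin n → E3 => ∏ i, φ i (x i) :=
  continuous_finsetProd _ fun i _ => (φ i).continuous.comp (continuous_apply i)

/-- The product of bumps is nonnegative. -/
private theorem mt_prod_bump_nonneg (φ : ∀ i, ContDiffBump (z i)) (x : Fin n → E3) :
    0 ≤ ∏ i, φ i (x i) :=
  Finset.prod_nonneg fun i _ => (φ i).nonneg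

/-- The product of bumps with outer radii `≤ r` (`0 < r`) is supported in the closed sup-ball of radius `r`
around the centre configuration. -/
private theorem mt_prod_bump_support (φ : ∀ i, ContDiffBump (z i)) {r : ℝ} (hr0 : 0 < r)
    (hr : ∀ i, (φ i).rOut ≤ r) :
    Function.support (fun x : Fin n → E3 => ∏ i, φ i (x i)) ⊆ closedBall z r := by
  intro x hx
  rw [Function.mem_support] at hx
  rw [mem_closedBall, dist_pi_le_iff hr0.le]
  intro i
  by_contra h
  push Not at h
  exact hx (Finset.prod_eq_zero (Finset.mem_univ i) ((φ i).zero_of_le_dist ((hr i).trans h.le)))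

/-- The integral of the product of bumps is positive (Fubini and `ContDiffBump.integral_pos`). -/
private theorem mt_prod_bump_integral_pos (φ : ∀ i, ContDiffBump (z i)) :
    0 < ∫ x : Fin n → E3, ∏ i, φ i (x i) := by
  have h : ∫ x : Fin n → E3, ∏ i, φ i (x i) = ∏ i, ∫ y, φ i y :=
    integral_fintype_prod_volume_eq_prod (fun i y => φ i y)
  rw [h]
  exact Finset.prod_pos fun i _ => (φ i).integral_pos

end Bumps

/-! ## The localisation lemma: equal bump-averages of continuous functions force equal values -/

section Localise

variable {n : ℕ}

/-- One-sided localisation: if `∫ F ∏φᵢ = ∫ G ∏φᵢ` for all bump families centred at `z ∈ U` with small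
radii, and `F`, `G` are continuous on the open set `U`, then `F z ≤ G z`. -/
private theorem mt_le_of_forall_bump {U : Set (Fin n → E3)} (hU : IsOpen U) {z : Fin n → E3}
    (hz : z ∈ U) {F G : (Fin n → E3) → ℝ} (hF : ContinuousOn F U) (hG : ContinuousOn G U) {ε : ℝ}
    (hε : 0 < ε)
    (hFG : ∀ φ : (∀ i, ContDiffBump (z i)), (∀ i, (φ i).rOut < ε) →
      ∫ x, F x * ∏ i, φ i (x i) = ∫ x, G x * ∏ i, φ i (x i)) :
    F z ≤ G z := by
  by_contra hlt
  push Not at hlt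
  set δ : ℝ := (F z - G z) / 2 with hδ
  have hδ0 : 0 < δ := by rw [hδ]; linarith
  have hδlt : δ < F z - G z := by rw [hδ]; linarith
  -- a sup-ball around `z` inside `U` on which `F - G > δ`
  have hcont : ContinuousAt (fun x => F x - G x) z := (hF.sub hG).continuousAt (hU.mem_nhds hz)
  have hev : ∀ᶠ x in 𝓝 z, x ∈ U ∧ δ < F x - G x :=
    (hU.eventually_mem hz).and (continuousAt_const.eventually_lt hcont hδlt)
  obtain ⟨r, hr0, hr⟩ := Metric.eventually_nhds_iff.1 hev
  -- the bumps, of outer radius `ρ < min ε r`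
  set ρ : ℝ := min (ε / 2) (r / 2) with hρ
  have hρ0 : 0 < ρ := by rw [hρ]; positivity
  have hρε : ρ < ε := by rw [hρ]; exact (min_le_left _ _).trans_lt (by linarith)
  have hρr : ρ < r := by rw [hρ]; exact (min_le_right _ _).trans_lt (by linarith)
  obtain ⟨φ, hφ⟩ : ∃ φ : ∀ i, ContDiffBump (z i), ∀ i, (φ i).rOut = ρ :=
    ⟨fun i => ⟨ρ / 2, ρ, by positivity, by linarith⟩, fun _ => rfl⟩
  have hid := hFG φ fun i => (hφ i).le.trans_lt hρε
  set ψ : (Fin n → E3) → ℝ := fun x => ∏ i, φ i (x i) with hψ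
  -- support and regularity of `ψ`
  have hψc : Continuous ψ := mt_prod_bump_continuous φ
  have hψsupp : Function.support ψ ⊆ closedBall z ρ :=
    mt_prod_bump_support φ hρ0 fun i => (hφ i).le
  have hballU : closedBall z ρ ⊆ U := fun x hx => (hr ((mem_closedBall.1 hx).trans_lt hρr)).1
  have hψt : tsupport ψ ⊆ U := (closure_minimal hψsupp isClosed_closedBall).trans hballU
  have hψcs : HasCompactSupport ψ :=
    HasCompactSupport.of_support_subset_isCompact (isCompact_closedBall z ρ) hψsupp
  have hint : ∀ {H : (Fin n → E3) → ℝ}, ContinuousOn H U → Integrable fun x => H x * ψ x := by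
    intro H hH
    have hc : Continuous fun x => H x * ψ x :=
      (hH.mul hψc.continuousOn).continuous_of_tsupport_subset hU
        ((tsupport_mul_subset_right (f := H) (g := ψ)).trans hψt)
    exact hc.integrable_of_hasCompactSupport (hψcs.mul_left (f := H))
  -- `∫ (F - G) ψ = 0`
  have h1 : ∫ x, (F x - G x) * ψ x = 0 := by
    simp_rw [sub_mul]
    rw [integral_sub (hint hF) (hint hG), hid, sub_self]
  -- but `(F - G) ψ ≥ δ ψ` pointwise and `∫ ψ > 0`
  have h2 : ∀ x, δ * ψ x ≤ (F x - G x) * ψ x := by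
    intro x
    by_cases hx : ψ x = 0
    · rw [hx, mul_zero, mul_zero]
    · have hxU := hr ((mem_closedBall.1 (hψsupp hx)).trans_lt hρr)
      exact mul_le_mul_of_nonneg_right hxU.2.le (mt_prod_bump_nonneg φ x)
  have h3 : δ * ∫ x, ψ x ≤ ∫ x, (F x - G x) * ψ x := by
    rw [← integral_const_mul]
    exact integral_mono ((hψc.integrable_of_hasCompactSupport hψcs).const_mul δ)
      (hint (hF.sub hG)) h2
  have h4 : 0 < ∫ x, ψ x := mt_prod_bump_integral_pos φ
  have h5 : 0 < δ * ∫ x, ψ x := mul_pos hδ0 h4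
  linarith

/-- **Localisation.** If `∫ F ∏φᵢ = ∫ G ∏φᵢ` for all bump families centred at `z ∈ U` with small radii, and
`F`, `G` are continuous on the open set `U`, then `F z = G z`. -/
private theorem mt_eq_of_forall_bump {U : Set (Fin n → E3)} (hU : IsOpen U) {z : Fin n → E3}
    (hz : z ∈ U) {F G : (Fin n → E3) → ℝ} (hF : ContinuousOn F U) (hG : ContinuousOn G U) {ε : ℝ}
    (hε : 0 < ε)
    (hFG : ∀ φ : (∀ i, ContDiffBump (z i)), (∀ i, (φ i).rOut < ε) →
      ∫ x, F x * ∏ i, φ i (x i) = ∫ x, G x * ∏ i, φ i (x i)) :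
    F z = G z :=
  le_antisymm (mt_le_of_forall_bump hU hz hF hG hε hFG)
    (mt_le_of_forall_bump hU hz hG hF hε fun φ hφ => (hFG φ hφ).symm)

end Localise

/-! ## The inverted density and the smeared identity -/

section Model

variable {n : ℕ}

/-- The inverted, reweighted density `x ↦ S(ι x₁, …, ι xₙ) ∏ᵢ (1/‖xᵢ‖²)^Δ` is continuous on the off-origin
non-coincident configurations when `S n` is continuous on the non-coincident ones. -/
private theorem mt_continuousOn_inverted {S : CorrFamily 3}
    (hcont : ContinuousOn (S n) (NonCoincident 3 n)) (Δ : ℝ) :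
    ContinuousOn
      (fun x : Fin n → E3 => S n (fun i => inversion 0 1 (x i)) * ∏ i, (1 / ‖x i‖ ^ 2) ^ Δ)
      (NonCoincident 3 n ∩ {x | ∀ i, x i ≠ 0}) := by
  refine ContinuousOn.mul ?_ ?_
  · refine hcont.comp (f := fun (x : Fin n → E3) i => inversion 0 1 (x i))
      (continuousOn_pi.2 fun i => ?_) (fun x hx => ?_)
    · exact ConformalChart.contDiffOn_unitInversion.continuousOn.comp
        (continuous_apply i).continuousOn fun x hx => hx.2 i
    · exact (inversion_injective (0 : E3) one_ne_zero).comp hx.1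
  · refine continuousOn_finsetProd _ fun i _ => ?_
    have hne : ∀ x ∈ NonCoincident 3 n ∩ {x : Fin n → E3 | ∀ i, x i ≠ 0}, ‖x i‖ ^ 2 ≠ 0 :=
      fun x hx => pow_ne_zero _ (norm_ne_zero_iff.2 (hx.2 i))
    refine ContinuousOn.rpow_const ?_ fun x hx => Or.inl (div_ne_zero one_ne_zero (hne x hx))
    exact continuousOn_const.div ((continuous_norm.comp (continuous_apply i)).pow 2).continuousOn hne

/-- **The smeared identity.** For Schwartz functions `hᵢ` compactly supported in an annulus `R_s`, moment
invariance under `ι^*_Δ`, the moment density and the change of variables `integral_sphereInversion_transfer`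
give `∫ S(x) ∏ hᵢ(xᵢ) dx = ∫ (S(ι x) ∏ (1/‖xᵢ‖²)^Δ) ∏ hᵢ(xᵢ) dx`. -/
private theorem mt_smeared_identity {Δ : ℝ} {S : CorrFamily 3} {μ : Measure (FieldConfig E3)}
    (hdens : HasMomentDensity μ S)
    (hinv : ∀ s : ℝ, 0 < s → s < 1 → ∀ (n : ℕ) (f : Fin n → 𝓢(E3, ℝ)),
      (∀ i, (HasCompactSupport (f i : E3 → ℝ) ∧
        tsupport (f i : E3 → ℝ) ⊆ {x : E3 | s < ‖x‖ ∧ ‖x‖ < s⁻¹})) →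
      moment μ n (fun i => moebiusWeightedAction ConformalChart.unitInversion Δ (f i)) = moment μ n f)
    {s : ℝ} (hs : 0 < s) (hs1 : s < 1) (h : Fin n → 𝓢(E3, ℝ))
    (hh : ∀ i, (HasCompactSupport (h i : E3 → ℝ) ∧
      tsupport (h i : E3 → ℝ) ⊆ {x : E3 | s < ‖x‖ ∧ ‖x‖ < s⁻¹})) :
    ∫ x : Fin n → E3, S n x * ∏ i, h i (x i) =
      ∫ x : Fin n → E3, (S n (fun i => inversion 0 1 (x i)) * ∏ i, (1 / ‖x i‖ ^ 2) ^ Δ) *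
        ∏ i, h i (x i) := by
  have h1 := hinv s hs hs1 n h hh
  rw [hdens, hdens] at h1
  rw [← h1]
  have h0 : ∀ i, (0 : E3) ∉ tsupport (h i : E3 → ℝ) := fun i h0 => by
    have := (hh i).2 h0
    rw [mem_setOf_eq, norm_zero] at this
    exact lt_irrefl (0 : ℝ) (hs.trans this.1)
  have hft : ∀ i, tsupport (h i : E3 → ℝ) ⊆ ({0}ᶜ : Set E3) := fun i x hx hx0 => by
    rw [mem_singleton_iff] at hx0
    exact h0 i (hx0 ▸ hx)
  have hval0 : ∀ i, h i 0 = 0 := fun i => image_eq_zero_of_notMem_tsupport (h0 i)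
  have hpt : ∀ x : Fin n → E3,
      S n x * ∏ i, moebiusWeightedAction ConformalChart.unitInversion Δ (h i) (x i) =
        S n x * ∏ i, ((1 / ‖x i‖ ^ 2) ^ ((3 : ℝ) - Δ) * h i ((1 / ‖x i‖ ^ 2) • x i)) := by
    intro x
    congr 1
    refine Finset.prod_congr rfl fun i _ => ?_
    by_cases hx : x i = 0
    · rw [hx, smul_zero, hval0 i, mul_zero]
      exact moebiusWeightedAction_apply_of_not_mem (h i) (by simp)
    · rw [sphereInversion_eq_smul_inversion 1 (x i), one_smul, one_div,
        moebiusWeightedAction_unitInversion_apply (hh i).1 (hft i) hx, finrank_euclideanSpace_fin]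
      norm_num
  have key : (∫ x : Fin n → E3,
      S n x * ∏ i, ((1 / ‖x i‖ ^ 2) ^ ((3 : ℝ) - Δ) * h i ((1 / ‖x i‖ ^ 2) • x i))) =
      ∫ x : Fin n → E3, (S n (fun i => (1 / ‖x i‖ ^ 2) • x i) * ∏ i, (1 / ‖x i‖ ^ 2) ^ Δ) *
        ∏ i, h i (x i) :=
    integral_sphereInversion_transfer n 1 one_pos Δ (S n) (fun i => ⇑(h i)) hval0
  simp_rw [hpt]
  rw [key]
  simp_rw [sphereInversion_eq_smul_inversion 1, one_smul]

end Model

/-- Registered stub `stub_momentTransfer` of crux `BallSpecifiedInversionUpgrade` (stmt-CriticalPhenomena-11248), line `birth` r2. -/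
theorem stub_momentTransfer :
    ∀ (Δ : ℝ) (S : Literature.Probability.LatticeModels.CorrFamily 3) (μ : MeasureTheory.Measure (Literature.MathematicalPhysics.QuantumLattice.FieldConfig (EuclideanSpace ℝ (Fin 3)))), (∀ n, ContinuousOn (S n) (Literature.Probability.LatticeModels.NonCoincident 3 n)) → (∀ n z, z ∉ Literature.Probability.LatticeModels.NonCoincident 3 n → S n z = 0) → Literature.MathematicalPhysics.QuantumLattice.HasMomentDensity μ S → (∀ s : ℝ, 0 < s → s < 1 → ∀ (n : ℕ) (f : Fin n → SchwartzMap (EuclideanSpace ℝ (Fin 3)) ℝ), (∀ i, (HasCompactSupport (f i : EuclideanSpace ℝ (Fin 3) → ℝ) ∧ tsupport (f i : EuclideanSpace ℝ (Fin 3) → ℝ) ⊆ {x : EuclideanSpace ℝ (Fin 3) | s < ‖x‖ ∧ ‖x‖ < s⁻¹})) → Literature.MathematicalPhysics.QuantumLattice.moment μ n (fun i => Literature.Probability.LatticeModels.moebiusWeightedAction Literature.Probability.LatticeModels.ConformalChart.unitInversion Δ (f i)) = Literature.MathematicalPhysics.QuantumLattice.moment μ n f) → Literature.Probability.LatticeModels.IsInversionCovariant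 Δ S := by
  intro Δ S μ hcont hnorm hdens hinv n y hy
  by_cases hinj : Function.Injective y
  · -- non-coincident, off-origin configuration: localise the smeared identity at `y`
    set U : Set (Fin n → E3) := NonCoincident 3 n ∩ {x | ∀ i, x i ≠ 0}
    have hU : IsOpen U := (isOpen_nonCoincident 3 n).inter (isOpen_forall_ne_zero n)
    have hyU : y ∈ U := ⟨hinj, hy⟩
    have hF : ContinuousOn (S n) U := (hcont n).mono inter_subset_left
    set G : (Fin n → E3) → ℝ :=
      fun x => S n (fun i => inversion 0 1 (x i)) * ∏ i, (1 / ‖x i‖ ^ 2) ^ Δ with hGdef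
    have hG : ContinuousOn G U := mt_continuousOn_inverted (hcont n) Δ
    obtain ⟨ε, hε0, -, hεy⟩ := mt_exists_small (fun i => ‖y i‖) fun i => norm_pos_iff.2 (hy i)
    have key : S n y = G y := by
      refine mt_eq_of_forall_bump hU hyU hF hG hε0 fun φ hφ => ?_
      -- an annulus `R_s` containing all the supports `closedBall (y i) (φ i).rOut`
      obtain ⟨s, hs0, hs1, hsa⟩ := mt_exists_small (fun i => min (‖y i‖ - ε) (‖y i‖ + ε)⁻¹)
        fun i => lt_min (sub_pos.2 (hεy i)) (inv_pos.2 (by positivity))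
      have hsupp : ∀ i, tsupport (φ i : E3 → ℝ) ⊆ {x : E3 | s < ‖x‖ ∧ ‖x‖ < s⁻¹} := by
        intro i x hx
        rw [(φ i).tsupport_eq, mem_closedBall, dist_eq_norm] at hx
        obtain ⟨hsl, hsr⟩ := lt_min_iff.1 (hsa i)
        have h1 := norm_sub_norm_le (y i) x
        have h2 := norm_sub_norm_le x (y i)
        rw [norm_sub_rev] at h1
        have h3 : ‖y i‖ + ε < s⁻¹ := (lt_inv_comm₀ hs0 (by positivity)).1 hsr
        have h4 := hφ i
        exact ⟨by linarith, by linarith⟩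
      have hid := mt_smeared_identity hdens hinv hs0 hs1
        (fun i => (φ i).hasCompactSupport.toSchwartzMap (φ i).contDiff)
        fun i => ⟨(φ i).hasCompactSupport, hsupp i⟩
      exact hid
    rw [key, hGdef]
    have hprod : (∏ i, ‖y i‖ ^ (2 * Δ)) * ∏ i, (1 / ‖y i‖ ^ 2) ^ Δ = 1 := by
      rw [← Finset.prod_mul_distrib]
      refine Finset.prod_eq_one fun i _ => ?_
      have hpos : 0 < ‖y i‖ := norm_pos_iff.2 (hy i)
      have h2 : (0 : ℝ) < ‖y i‖ ^ 2 := by positivity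
      rw [Real.rpow_mul hpos.le, Real.rpow_two, one_div, Real.inv_rpow h2.le,
        mul_inv_cancel₀ (Real.rpow_pos_of_pos h2 Δ).ne']
    simp only
    rw [mul_left_comm, hprod, mul_one]
  · -- coincident configuration: both sides vanish by normalisation
    have h1 : ¬ Function.Injective (fun i => inversion 0 1 (y i)) := fun h =>
      hinj (Function.Injective.of_comp (f := inversion (0 : E3) 1) h)
    rw [hnorm n y hinj, hnorm n (fun i => inversion 0 1 (y i)) h1, mul_zero]

end Summit.CriticalPhenomena.Ising3DConformalLimit.BallSpecificationBallSpecifiedInversionUpgrade
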